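import Mathlib
import Summits.ValiantsHypothesis.ValiantsHypothesis.Theorems.NewtonUnitEquationsDissociatedUniformTotalsLaw
import Summits.ValiantsHypothesis.ValiantsHypothesis.Theorems.NewtonUnitEquationsDissociatedUniformTotalsLawUnionVertLowerGrid
import HarnessLib

/-!
# Crux `NewtonUnitEquations.DissociatedUniform` (stmt-ValiantsHypothesis-5905): the PARABOLA GADGET — one class of (Q**) with
# `q²/4` hull vertices, for injective curves (kernel record of NOTES-d1g3 §2 L2)

The founding census memo `Cruxes/DissociatedUniform/NOTES-d1g3.md` §2 L2 (paper proof, 10 lines) exhibits, for every `q`, three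
INJECTIVE curves over `ℤ/q` one of whose classes has at least `q²/4` hull vertices — so the `n = 3` totals law `T ≤ C·q²`
(`TotalsLawThree`, OPEN) can only be a statement about the SUM over classes, never a pointwise one (`V_s ≤ C·q` is false for every
`C`; the trivial pointwise bound is `V_s ≤ q² + q`, `classVert_le_fibreTotal_add_card`).  This file is its kernel record (it
complements this seat's `…TotalsLawUnionVertLower`: pointwise UNIONS of fibres reach `Θ(q^{4/3})`, pointwise CLASSES reach `Θ(q²)`).
The gadget (`q = 2T`, `H = 200T⁴`):
  `a x = (x, (1 − T)x² + H·[x ≥ T])`, `b y = (Ty, (T² − T)y² + H·[y ≥ T])`, `c z = (0, T·((2T−2−z) mod q)²)`;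
in the class `s* = 2T − 2` the words with digits `x, y < T` have `z`-term `T(x + y)²` and land EXACTLY on the parabola
`(X, X²)`, `X = x + Ty` ranging over `[0, T²)`; every other word of the class carries an `H` and lies far above.  Each parabola
point is the strict top of the class for the weight `(2X₀, −1)` (`score = X₀² − (X − X₀)²` on the parabola, `< 0` off it), hence a
hull vertex: `T² = q²/4 ≤ V_{s*}`.
* `Gadget.g1/g2/g3`, their injectivity; `Gadget.sq_le_classVert : T² ≤ classVert g1 g2 g3 s*`;
* `exists_classVert_gt : ∀ C, ∃ q a b c s (all injective), C·q < classVert a b c s` — NO POINTWISE `n = 3` LAW.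
Honest label: kernel record of a known census construction; `TotalsLawThree`, `UnionTotalsLaw` remain OPEN; nothing here bears on
VP ≠ VNP.
[folklore: strict linear maximisers of a finite planar set are hull vertices]
-/

set_option linter.dupNamespace false -- `ValiantsHypothesis.ValiantsHypothesis` (summit = problem) in every name

open scoped BigOperators

namespace Summit.ValiantsHypothesis.ValiantsHypothesis.Theorems.NewtonUnitEquationsDissociatedUniform

namespace TotalsLaw

namespace Gadget

open Literature.Computability.AlgebraicComplexity.KPTT.PlanarMinkowski UVBCex

variable (T : ℕ) [NeZero T]

/-- The ballast height `H = 200T⁴`. -/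
noncomputable def Hc : ℝ := 200 * (T : ℝ) ^ 4

/-- The ballast indicator: `H` on the upper half `[T, 2T)` of the alphabet, `0` on the lower half. -/
noncomputable def ball (n : ℕ) : ℝ := if T ≤ n then Hc T else 0

/-- First curve `a x = (x, (1 − T)x² + H·[x ≥ T])`. -/
noncomputable def g1 (x : ZMod (2 * T)) : Fin 2 → ℝ :=
  ![(x.val : ℝ), (1 - (T : ℝ)) * (x.val : ℝ) ^ 2 + ball T x.val]

/-- Second curve `b y = (Ty, (T² − T)y² + H·[y ≥ T])`. -/
noncomputable def g2 (y : ZMod (2 * T)) : Fin 2 → ℝ :=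
  ![(T : ℝ) * y.val, ((T : ℝ) ^ 2 - T) * (y.val : ℝ) ^ 2 + ball T y.val]

/-- The distinguished class `s* = 2T − 2`. -/
def sStar : ZMod (2 * T) := ((2 * T - 2 : ℕ) : ZMod (2 * T))

/-- Third curve `c z = (0, T·((s* − z) mod q)²)`. -/
noncomputable def g3 (z : ZMod (2 * T)) : Fin 2 → ℝ :=
  ![0, (T : ℝ) * (((sStar T - z).val : ℕ) : ℝ) ^ 2]

/-- `a` is injective (first coordinates are the representatives). -/
theorem g1_injective : Function.Injective (g1 T) := by
  intro x x' h
  have h0 := congrFun h 0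
  simp only [g1, Matrix.cons_val_zero, Nat.cast_inj] at h0
  exact ZMod.val_injective _ h0

/-- `b` is injective. -/
theorem g2_injective : Function.Injective (g2 T) := by
  intro y y' h
  have h0 := congrFun h 0
  simp only [g2, Matrix.cons_val_zero] at h0
  have hT : (T : ℝ) ≠ 0 := by exact_mod_cast NeZero.ne T
  have : (y.val : ℝ) = y'.val := mul_left_cancel₀ hT h0
  exact ZMod.val_injective _ (by exact_mod_cast this)

/-- `c` is injective. -/
theorem g3_injective : Function.Injective (g3 T) := by
  intro z z' h
  have h1 := congrFun h 1
  simp only [g3, Matrix.cons_val_one, Matrix.cons_val_zero] at h1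
  have hT : (T : ℝ) ≠ 0 := by exact_mod_cast NeZero.ne T
  have h2 : (((sStar T - z).val : ℕ) : ℝ) ^ 2 = (((sStar T - z').val : ℕ) : ℝ) ^ 2 := mul_left_cancel₀ hT h1
  have h3 : (((sStar T - z).val : ℕ) : ℝ) = ((sStar T - z').val : ℕ) := by
    have := (sq_eq_sq₀ (Nat.cast_nonneg _) (Nat.cast_nonneg _)).1 h2
    exact this
  have h4 : sStar T - z = sStar T - z' := ZMod.val_injective _ (by exact_mod_cast h3)
  exact sub_right_injective h4

/-! ### The words of the class `s*` -/

omit [NeZero T] in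
/-- The `c`-letter of the word `(x, y)` of class `s*` is `s* − x − y`, and `s* − (s* − x − y) = x + y`. -/
theorem g3_word (x y : ZMod (2 * T)) :
    g3 T (sStar T - x - y) = ![0, (T : ℝ) * (((x + y).val : ℕ) : ℝ) ^ 2] := by
  simp only [g3, show sStar T - (sStar T - x - y) = x + y by ring]

/-- A LOW word (`x, y < T`): the sum has representative `x + y` (no wrap, `q = 2T`). -/
theorem val_add_of_lt {x y : ZMod (2 * T)} (hx : x.val < T) (hy : y.val < T) : (x + y).val = x.val + y.val := by
  rw [ZMod.val_add]
  exact Nat.mod_eq_of_lt (by omega)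

/-- The score of a planar point against the weight `(2X₀, −1)`. -/
theorem dot_w (X₀ e f : ℝ) : ![2 * X₀, -1] ⬝ᵥ ![e, f] = 2 * X₀ * e - f := dot_vec2 _ _ _

/-- **Low words lie on the parabola**: for `x, y < T` the class-`s*` point is `(X, X²)` with `X = x + Ty`. -/
theorem low_word {x y : ZMod (2 * T)} (hx : x.val < T) (hy : y.val < T) :
    g1 T x + g2 T y + g3 T (sStar T - x - y) =
      ![(x.val : ℝ) + T * y.val, ((x.val : ℝ) + T * y.val) ^ 2] := by
  rw [g3_word, val_add_of_lt T hx hy]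
  have hbx : ball T x.val = 0 := by simp [ball, Nat.not_le.2 hx]
  have hby : ball T y.val = 0 := by simp [ball, Nat.not_le.2 hy]
  simp only [g1, g2, hbx, hby]
  ext i
  fin_cases i
  · simp
  · simp; ring

/-- Components of a class-`s*` word. -/
theorem word_apply_zero (x y : ZMod (2 * T)) :
    (g1 T x + g2 T y + g3 T (sStar T - x - y)) 0 = (x.val : ℝ) + T * y.val := by
  rw [g3_word]; simp [g1, g2]

/-- Components of a class-`s*` word. -/
theorem word_apply_one (x y : ZMod (2 * T)) :
    (g1 T x + g2 T y + g3 T (sStar T - x - y)) 1 =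
      (1 - (T : ℝ)) * (x.val : ℝ) ^ 2 + ball T x.val + (((T : ℝ) ^ 2 - T) * (y.val : ℝ) ^ 2 + ball T y.val) +
        (T : ℝ) * (((x + y).val : ℕ) : ℝ) ^ 2 := by
  rw [g3_word]; simp [g1, g2]

/-- **High words lie far above**: if `x ≥ T` or `y ≥ T`, the second coordinate of the class-`s*` point is at least `H − 4T³`, and its
first coordinate is in `[0, 2T(T+1)]`. -/
theorem high_word {x y : ZMod (2 * T)} (h : T ≤ x.val ∨ T ≤ y.val) :
    Hc T - 4 * (T : ℝ) ^ 3 ≤ (g1 T x + g2 T y + g3 T (sStar T - x - y)) 1 ∧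
      0 ≤ (g1 T x + g2 T y + g3 T (sStar T - x - y)) 0 ∧
      (g1 T x + g2 T y + g3 T (sStar T - x - y)) 0 ≤ 2 * (T : ℝ) * (T + 1) := by
  have hT1 : (1 : ℝ) ≤ T := by exact_mod_cast Nat.one_le_iff_ne_zero.2 (NeZero.ne T)
  have hxq : (x.val : ℝ) ≤ 2 * T := by exact_mod_cast (ZMod.val_lt x).le
  have hyq : (y.val : ℝ) ≤ 2 * T := by exact_mod_cast (ZMod.val_lt y).le
  have hx0 : (0 : ℝ) ≤ x.val := Nat.cast_nonneg _
  have hy0 : (0 : ℝ) ≤ y.val := Nat.cast_nonneg _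
  have hH : 0 ≤ Hc T := by unfold Hc; positivity
  have hbx0 : 0 ≤ ball T x.val := by unfold ball; split_ifs <;> [exact hH; exact le_rfl]
  have hby0 : 0 ≤ ball T y.val := by unfold ball; split_ifs <;> [exact hH; exact le_rfl]
  have hballs : Hc T ≤ ball T x.val + ball T y.val := by
    rcases h with h | h
    · have : ball T x.val = Hc T := by simp [ball, h]
      linarith
    · have : ball T y.val = Hc T := by simp [ball, h]
      linarith
  rw [word_apply_zero, word_apply_one]
  refine ⟨?_, by positivity, by nlinarith⟩
  have hx2 : (x.val : ℝ) ^ 2 ≤ (2 * T) ^ 2 := pow_le_pow_left₀ hx0 hxq 2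
  have h1 : -(4 * (T : ℝ) ^ 3) ≤ (1 - (T : ℝ)) * (x.val : ℝ) ^ 2 := by
    nlinarith [mul_le_mul_of_nonneg_left hx2 (by linarith : (0 : ℝ) ≤ T - 1)]
  have h2 : 0 ≤ ((T : ℝ) ^ 2 - T) * (y.val : ℝ) ^ 2 := mul_nonneg (by nlinarith) (sq_nonneg _)
  have h3 : 0 ≤ (T : ℝ) * (((x + y).val : ℕ) : ℝ) ^ 2 := by positivity
  linarith

/-! ### The certified vertices: every parabola point is the strict top of the class for the weight `(2X₀, −1)` -/

/-- Finset model of the class (the tree's `clFin` pattern, here directly as an image over `G × G`). -/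
noncomputable def clF (s : ZMod (2 * T)) : Finset (Fin 2 → ℝ) :=
  (Finset.univ : Finset (ZMod (2 * T) × ZMod (2 * T))).image fun p => g1 T p.1 + g2 T p.2 + g3 T (s - p.1 - p.2)

/-- Its carrier is the class. -/
theorem coe_clF (s : ZMod (2 * T)) : (clF T s : Set (Fin 2 → ℝ)) = classPts (g1 T) (g2 T) (g3 T) s := by
  ext p
  simp only [clF, Finset.coe_image, Finset.coe_univ, Set.image_univ, classPts]

/-- Digits: `x + Ty = x' + Ty'` with `x, x' < T` forces `(x, y) = (x', y')`. -/
theorem digits_inj {x y x' y' : ℕ} (hx : x < T) (hx' : x' < T) (h : x + T * y = x' + T * y') : x = x' ∧ y = y' := by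
  have h1 : x % T = x' % T := by
    have := congrArg (· % T) h
    simpa [Nat.add_mul_mod_self_left] using this
  rw [Nat.mod_eq_of_lt hx, Nat.mod_eq_of_lt hx'] at h1
  refine ⟨h1, ?_⟩
  subst h1
  have hT : 0 < T := Nat.pos_of_ne_zero (NeZero.ne T)
  have := Nat.eq_of_mul_eq_mul_left hT (by omega : T * y = T * y')
  exact this

/-- **Strict top.**  For `x₀, y₀ < T`, the parabola point of `(x₀, y₀)` beats every other point of class `s*` for the weight
`(2X₀, −1)`, `X₀ = x₀ + Ty₀`. -/
theorem strict_top {x₀ y₀ : ZMod (2 * T)} (hx₀ : x₀.val < T) (hy₀ : y₀.val < T) :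
    IsStrictTop ![2 * ((x₀.val : ℝ) + T * y₀.val), -1] (clF T (sStar T))
      (g1 T x₀ + g2 T y₀ + g3 T (sStar T - x₀ - y₀)) := by
  classical
  have hT1 : (1 : ℝ) ≤ T := by exact_mod_cast Nat.one_le_iff_ne_zero.2 (NeZero.ne T)
  have hX₀0 : 0 ≤ (x₀.val : ℝ) + T * y₀.val := by positivity
  have hX₀le : (x₀.val : ℝ) + T * y₀.val ≤ (T : ℝ) ^ 2 := by
    have h1 : (x₀.val : ℝ) + 1 ≤ T := by exact_mod_cast hx₀
    have h2 : (y₀.val : ℝ) + 1 ≤ T := by exact_mod_cast hy₀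
    nlinarith
  refine ⟨Finset.mem_image.2 ⟨(x₀, y₀), Finset.mem_univ _, rfl⟩, fun p hp hne => ?_⟩
  obtain ⟨⟨x, y⟩, -, rfl⟩ := Finset.mem_image.1 hp
  rw [low_word T hx₀ hy₀] at hne ⊢
  rw [dot_w]
  by_cases hlow : x.val < T ∧ y.val < T
  · -- another parabola point: distinct abscissa
    rw [low_word T hlow.1 hlow.2] at hne ⊢
    rw [dot_w]
    have hXne : (x.val : ℝ) + T * y.val ≠ (x₀.val : ℝ) + T * y₀.val := by
      intro hXX
      apply hne
      have hnat : x.val + T * y.val = x₀.val + T * y₀.val := by exact_mod_cast hXX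
      obtain ⟨e1, e2⟩ := digits_inj T hlow.1 hx₀ hnat
      rw [e1, e2]
    have hpos : 0 < ((x.val : ℝ) + T * y.val - ((x₀.val : ℝ) + T * y₀.val)) ^ 2 :=
      sq_pos_of_ne_zero (sub_ne_zero.2 hXne)
    nlinarith
  · -- a high word: far above
    have h' : T ≤ x.val ∨ T ≤ y.val := by
      rcases Nat.lt_or_ge x.val T with hx | hx
      · rcases Nat.lt_or_ge y.val T with hy | hy
        · exact absurd ⟨hx, hy⟩ hlow
        · exact Or.inr hy
      · exact Or.inl hx
    obtain ⟨h1, h0, h0'⟩ := high_word T h'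
    have hPe : g1 T x + g2 T y + g3 T (sStar T - x - y) =
        ![(g1 T x + g2 T y + g3 T (sStar T - x - y)) 0, (g1 T x + g2 T y + g3 T (sStar T - x - y)) 1] := by
      ext i; fin_cases i <;> rfl
    rw [hPe, dot_w]
    have hHc : Hc T = 200 * (T : ℝ) ^ 4 := rfl
    have hprod : ((x₀.val : ℝ) + T * y₀.val) * (g1 T x + g2 T y + g3 T (sStar T - x - y)) 0 ≤
        (T : ℝ) ^ 2 * (2 * (T : ℝ) * (T + 1)) := mul_le_mul hX₀le h0' h0 (by positivity)
    have hT43 : (T : ℝ) ^ 3 ≤ (T : ℝ) ^ 4 := pow_le_pow_right₀ hT1 (by norm_num)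
    nlinarith

/-- The parabola points of distinct low digit pairs are distinct. -/
theorem low_point_inj {x y x' y' : ZMod (2 * T)} (hx : x.val < T) (hy : y.val < T) (hx' : x'.val < T) (hy' : y'.val < T)
    (h : g1 T x + g2 T y + g3 T (sStar T - x - y) = g1 T x' + g2 T y' + g3 T (sStar T - x' - y')) : x = x' ∧ y = y' := by
  rw [low_word T hx hy, low_word T hx' hy'] at h
  have h0 := congrFun h 0
  simp only [Matrix.cons_val_zero] at h0
  have hnat : x.val + T * y.val = x'.val + T * y'.val := by exact_mod_cast h0
  obtain ⟨e1, e2⟩ := digits_inj T hx hx' hnat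
  exact ⟨ZMod.val_injective _ e1, ZMod.val_injective _ e2⟩

/-! ### The count -/

/-- The low digits, as residues. -/
def lowDigits : Finset (ZMod (2 * T)) := (Finset.range T).image fun n : ℕ => (n : ZMod (2 * T))

omit [NeZero T] in
/-- A low digit has representative `< T`. -/
theorem val_lt_of_mem_lowDigits {x : ZMod (2 * T)} (hx : x ∈ lowDigits T) : x.val < T := by
  obtain ⟨n, hn, rfl⟩ := Finset.mem_image.1 hx
  rw [Finset.mem_range] at hn
  rw [ZMod.val_natCast, Nat.mod_eq_of_lt (by omega)]
  exact hn

omit [NeZero T] in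
/-- There are `T` low digits. -/
theorem card_lowDigits : (lowDigits T).card = T := by
  rw [lowDigits, Finset.card_image_of_injOn, Finset.card_range]
  intro n hn n' hn' h
  have hn2 : n < 2 * T := by have := Finset.mem_range.1 (Finset.mem_coe.1 hn); omega
  have hn2' : n' < 2 * T := by have := Finset.mem_range.1 (Finset.mem_coe.1 hn'); omega
  have := congrArg ZMod.val h
  rwa [ZMod.val_natCast, ZMod.val_natCast, Nat.mod_eq_of_lt hn2, Nat.mod_eq_of_lt hn2'] at this

/-- **`T² ≤ V_{s*}`**: the class `s* = 2T − 2` of the gadget over `ℤ/2T` has at least `T² = q²/4` hull vertices. -/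
theorem sq_le_classVert : T ^ 2 ≤ classVert (g1 T) (g2 T) (g3 T) (sStar T) := by
  classical
  let V : Finset (Fin 2 → ℝ) := (lowDigits T ×ˢ lowDigits T).image fun p => g1 T p.1 + g2 T p.2 + g3 T (sStar T - p.1 - p.2)
  have hcard : V.card = T ^ 2 := by
    rw [Finset.card_image_of_injOn, Finset.card_product, card_lowDigits, sq]
    rintro ⟨x, y⟩ hxy ⟨x', y'⟩ hxy' h
    simp only [Finset.coe_product, Set.mem_prod, Finset.mem_coe] at hxy hxy'
    obtain ⟨e1, e2⟩ := low_point_inj T (val_lt_of_mem_lowDigits T hxy.1) (val_lt_of_mem_lowDigits T hxy.2)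
      (val_lt_of_mem_lowDigits T hxy'.1) (val_lt_of_mem_lowDigits T hxy'.2) h
    rw [e1, e2]
  have hsub : (V : Set (Fin 2 → ℝ)) ⊆ (convexHull ℝ (classPts (g1 T) (g2 T) (g3 T) (sStar T))).extremePoints ℝ := by
    intro p hp
    obtain ⟨⟨x, y⟩, hxy, rfl⟩ := Finset.mem_image.1 (Finset.mem_coe.1 hp)
    rw [Finset.mem_product] at hxy
    have hst := strict_top T (val_lt_of_mem_lowDigits T hxy.1) (val_lt_of_mem_lowDigits T hxy.2)
    have := hst.mem_extremePoints
    rwa [coe_clF] at this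
  have hfin : ((convexHull ℝ (classPts (g1 T) (g2 T) (g3 T) (sStar T))).extremePoints ℝ).Finite :=
    (Set.finite_range _).subset extremePoints_convexHull_subset
  rw [← hcard]
  unfold classVert
  rw [← Set.ncard_coe_finset]
  exact Set.ncard_le_ncard hsub hfin

/-- `|ℤ/2T| = 2T`. -/
theorem card_G : Fintype.card (ZMod (2 * T)) = 2 * T := ZMod.card _

end Gadget

/-- **NO POINTWISE `n = 3` LAW**: for every `C` there are `q` and three INJECTIVE curves over `ℤ/q` with a class of more than `C·q`
hull vertices (the parabola gadget at `T = 2C + 1`, `q = 4C + 2`, class `s* = 2T − 2`, `V ≥ T² = (2C+1)² > C(4C+2)`).  Kernel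
record of NOTES-d1g3 §2 L2; the `n = 3` totals law `TotalsLawThree` is about the SUM over classes and stays OPEN. -/
theorem exists_classVert_gt (C : ℕ) :
    ∃ (q : ℕ) (_ : NeZero q) (a b c : ZMod q → (Fin 2 → ℝ)) (s : ZMod q),
      Function.Injective a ∧ Function.Injective b ∧ Function.Injective c ∧ C * q < classVert a b c s := by
  haveI : NeZero (2 * C + 1) := ⟨by omega⟩
  refine ⟨2 * (2 * C + 1), inferInstance, Gadget.g1 (2 * C + 1), Gadget.g2 (2 * C + 1), Gadget.g3 (2 * C + 1),
    Gadget.sStar (2 * C + 1), Gadget.g1_injective _, Gadget.g2_injective _, Gadget.g3_injective _, ?_⟩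
  have h := Gadget.sq_le_classVert (2 * C + 1)
  nlinarith

end TotalsLaw

end Summit.ValiantsHypothesis.ValiantsHypothesis.Theorems.NewtonUnitEquationsDissociatedUniform
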